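import Summits.MatrixMultiplication.OmegaCensus.DominoZ17StructSixArrC1
import Summits.MatrixMultiplication.OmegaCensus.DominoZ17StructSixArrC2
import Summits.MatrixMultiplication.OmegaCensus.DominoZ17StructSixArrC3
import Summits.MatrixMultiplication.OmegaCensus.DominoZ17StructSixArrC4
import Summits.MatrixMultiplication.OmegaCensus.DominoZ17StructSixArrC5
import Summits.MatrixMultiplication.OmegaCensus.DominoZ17StructSixArrC6
import HarnessLib

/-!
# The `y`-arrangement list of family `C` for the structural part-`6` route, `p = 17`: assembly

ω-census `pub-omega`, family (b3), seat pub-omega-group gen 25.  Framing: lottery ticket; floor = certified bounds/negative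
ranges.  VALUE: per-prime kernel data of the structural part-`6` route WITHOUT the pigeonhole (`DominoZpZpStructSixWide*.lean`)
for `p = 17` — target: the OPEN census cell `(1,6,16)@289` (`A = ℤ₁₇²`) and every larger order with such a quotient; NOT progress on ω.

`hyscZ17s6` (hypothesis `hYSc` of `exists_entry_structSixWide_of_checks`) from the per-representative decides.
-/

namespace Summit.MatrixMultiplication.OmegaCensus

open ZpZpDomino

namespace ZpZpDomino

/-- **Completeness of `yscZ17s6`**: every `arr6Y2`-arrangement of every representative that passes `dY6` is listed. [folklore] -/
theorem hyscZ17s6 : ∀ k ∈ rZ17s6, ∀ ys ∈ arr6Y2 17 k, dY6 ys = true → ys ∈ yscZ17s6 := by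
  have h : ∀ k ∈ rZ17s6, ((arr6Y2 17 k).all fun ys => !(dY6 ys) || yscZ17s6.contains ys) = true := by
    simp only [rZ17s6, List.forall_mem_cons]
    exact ⟨yscZ17s6_c0, yscZ17s6_c1, yscZ17s6_c2, yscZ17s6_c3, yscZ17s6_c4, yscZ17s6_c5, yscZ17s6_c6, yscZ17s6_c7, yscZ17s6_c8, yscZ17s6_c9, yscZ17s6_c10, yscZ17s6_c11, yscZ17s6_c12, yscZ17s6_c13, yscZ17s6_c14, yscZ17s6_c15, yscZ17s6_c16, yscZ17s6_c17, yscZ17s6_c18, yscZ17s6_c19, yscZ17s6_c20, yscZ17s6_c21, yscZ17s6_c22, yscZ17s6_c23, yscZ17s6_c24, yscZ17s6_c25, yscZ17s6_c26, yscZ17s6_c27, yscZ17s6_c28, yscZ17s6_c29, yscZ17s6_c30, yscZ17s6_c31, yscZ17s6_c32, yscZ17s6_c33, yscZ17s6_c34, yscZ17s6_c35, yscZ17s6_c36, yscZ17s6_c37, yscZ17s6_c38, yscZ17s6_c39, yscZ17s6_c40, yscZ17s6_c41, yscZ17s6_c42, yscZ17s6_c43, yscZ17s6_c44, yscZ17s6_c45,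 yscZ17s6_c46, yscZ17s6_c47, yscZ17s6_c48, yscZ17s6_c49, yscZ17s6_c50, yscZ17s6_c51, yscZ17s6_c52, yscZ17s6_c53, yscZ17s6_c54, yscZ17s6_c55, yscZ17s6_c56, yscZ17s6_c57, yscZ17s6_c58, yscZ17s6_c59, yscZ17s6_c60, yscZ17s6_c61, yscZ17s6_c62, yscZ17s6_c63, yscZ17s6_c64, yscZ17s6_c65, yscZ17s6_c66, yscZ17s6_c67, yscZ17s6_c68, fun _ h => (List.not_mem_nil h).elim⟩
  intro k hk ys hys hf
  have := List.all_eq_true.1 (h k hk) ys hys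
  rw [Bool.or_eq_true, hf] at this
  rcases this with h0 | h0
  · simp at h0
  · rwa [List.contains_iff_mem] at h0

end ZpZpDomino

end Summit.MatrixMultiplication.OmegaCensus
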